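import Literature.Topology.FourManifolds.Morse
import Literature.Topology.FourManifolds.MorseProofs
import Mathlib.Analysis.Calculus.FDeriv.CompCLM
import Mathlib.Analysis.Calculus.ContDiff.Basic
import Mathlib.LinearAlgebra.BilinearForm.Properties
import Mathlib.LinearAlgebra.QuadraticForm.IsometryEquiv
import Mathlib.Geometry.Manifold.MFDeriv.Atlas
import Mathlib.Geometry.Manifold.ContMDiff.NormedSpace
import HarnessLib

/-!
# The Hessian at a critical point does not depend on the chart

Topic `Literature/Topology/FourManifolds` (trunk FourManL, notion `kirby_calculus_handles`);
infrastructure for the fact item `provefact-Literature.SPC4.exists_isMorse_isSelfIndexing` (rung **E**,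
existence of Morse functions, and every argument that reads a Morse function in a chart other
than the preferred one).  Everything in this file is **proved**.

The tree's Hessian `Literature.mhessian I f x` is the second derivative of `f` written in the
*preferred* extended chart at `x` (`Morse.lean`: "this bilinear form depends on the chart in
general; at a critical point of a `C²` function its congruence class — hence `Nondegenerate`
and `sigNeg` — is intrinsic").  We prove that remark (Milnor, *Morse theory* (1963), §2, p. 4:
"this does not depend on the coordinate system. This follows from the invariant definition of
the Hessian as a symmetric bilinear functional `f_{**}` on `TM_p`"):

* `Literature.Topology.FourManifolds.fderiv_fderiv_comp_apply_of_fderiv_eq_zero` — the second-order chain rule at a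
  critical point: if `DF(τ u₀) = 0` then `D²(F ∘ τ)(u₀)(v, w) = D²F(τ u₀)(Dτ v, Dτ w)`.
* `Literature.hessianInChart I e f x` — the Hessian of `f` at `x` read in an arbitrary chart `e`
  (so that `hessianInChart I (chartAt H x) f x = mhessian I f x`,
  `Literature.Topology.FourManifolds.hessianInChart_chartAt`).
* `Literature.Topology.FourManifolds.mhessian_apply_eq_hessianInChart` — on a manifold without boundary, at a critical point
  of a `C²` function, `mhessian I f x (v, w) = hessianInChart I e f x (L v, L w)` for every
  chart `e` of the `C²` maximal atlas at `x`, where `L` (the derivative of the change of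
  coordinates) is a linear automorphism of the model space; hence
  `Literature.Topology.FourManifolds.nondegenerate_mhessian_iff` (nondegeneracy is chart-independent) and
  `Literature.Topology.FourManifolds.morseIndex_eq_sigNeg_hessianInChart` (so is the index, by Sylvester's law:
  `QuadraticMap.Equivalent.sigNeg_eq`).
* `Literature.Topology.FourManifolds.isMCriticalPt_iff_fderiv_comp_extend_symm_eq_zero` — being a critical point is read in
  any chart.

## References

* J. Milnor, *Morse theory*, Ann. of Math. Studies 51 (1963), §2 (pp. 4–6). [Milnor1963]
-/

open scoped Manifold ContDiff Topology
open Set Function Filter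

noncomputable section

namespace Literature.Topology.FourManifolds

/-! ### Calculus: the second-order chain rule at a critical point -/

section Calculus

variable {E E' : Type*} [NormedAddCommGroup E] [NormedSpace ℝ E] [NormedAddCommGroup E']
  [NormedSpace ℝ E']

/-- **Second-order chain rule at a critical point.**  If `F` is `C²` at `τ u₀`, `τ` is `C²` at
`u₀` and `DF(τ u₀) = 0`, then `D²(F ∘ τ)(u₀)(v, w) = D²F(τ u₀)(Dτ(u₀) v, Dτ(u₀) w)`: the term
`DF(τ u₀) ∘ D²τ(u₀)` of the general formula vanishes (Milnor 1963, §2, p. 4). [cite: Milnor1963, §2] -/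
theorem fderiv_fderiv_comp_apply_of_fderiv_eq_zero {F : E → ℝ} {τ : E' → E} {u₀ : E'}
    (hF : ContDiffAt ℝ 2 F (τ u₀)) (hτ : ContDiffAt ℝ 2 τ u₀) (hcrit : fderiv ℝ F (τ u₀) = 0)
    (v w : E') :
    fderiv ℝ (fderiv ℝ (F ∘ τ)) u₀ v w =
      fderiv ℝ (fderiv ℝ F) (τ u₀) (fderiv ℝ τ u₀ v) (fderiv ℝ τ u₀ w) := by
  -- near `u₀`, `D(F ∘ τ)(u) = DF(τ u) ∘ Dτ(u)`
  have hτd : ∀ᶠ u in 𝓝 u₀, DifferentiableAt ℝ τ u :=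
    (hτ.eventually (by simp)).mono fun u hu => hu.differentiableAt (by simp)
  have hFd : ∀ᶠ z in 𝓝 (τ u₀), DifferentiableAt ℝ F z :=
    (hF.eventually (by simp)).mono fun z hz => hz.differentiableAt (by simp)
  have hFd' : ∀ᶠ u in 𝓝 u₀, DifferentiableAt ℝ F (τ u) := hτ.continuousAt.eventually hFd
  have heq : fderiv ℝ (F ∘ τ) =ᶠ[𝓝 u₀] fun u => (fderiv ℝ F (τ u)).comp (fderiv ℝ τ u) :=
    (hFd'.and hτd).mono fun u hu => fderiv_comp u hu.1 hu.2
  rw [heq.fderiv_eq]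
  -- differentiate the composition of continuous linear maps
  have hc : HasFDerivAt (fun u => fderiv ℝ F (τ u))
      ((fderiv ℝ (fderiv ℝ F) (τ u₀)).comp (fderiv ℝ τ u₀)) u₀ := by
    have h1 : DifferentiableAt ℝ (fderiv ℝ F) (τ u₀) :=
      (hF.fderiv_right (m := 1) (by norm_num)).differentiableAt (by simp)
    have h2 : DifferentiableAt ℝ τ u₀ := hτ.differentiableAt (by simp)
    exact h1.hasFDerivAt.comp u₀ h2.hasFDerivAt
  have hd : HasFDerivAt (fun u => fderiv ℝ τ u) (fderiv ℝ (fderiv ℝ τ) u₀) u₀ :=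
    ((hτ.fderiv_right (m := 1) (by norm_num)).differentiableAt (by simp)).hasFDerivAt
  rw [(hc.clm_comp hd).fderiv]
  simp only [add_apply, ContinuousLinearMap.comp_apply,
    ContinuousLinearMap.flip_apply, ContinuousLinearMap.compL_apply, hcrit,
    ContinuousLinearMap.zero_comp, zero_add]

end Calculus

/-! ### Linear algebra: congruent bilinear forms -/

section Congruence

variable {E E' : Type*} [AddCommGroup E] [Module ℝ E] [AddCommGroup E'] [Module ℝ E']

/-- If `B' (v, w) = B (L v, L w)` for a linear isomorphism `L`, then `B'` is nondegenerate iff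
`B` is. [folklore] -/
theorem nondegenerate_iff_of_forall_apply_eq {B : LinearMap.BilinForm ℝ E}
    {B' : LinearMap.BilinForm ℝ E'} (L : E' ≃ₗ[ℝ] E) (h : ∀ v w, B' v w = B (L v) (L w)) :
    B'.Nondegenerate ↔ B.Nondegenerate := by
  have hB' : B' = LinearMap.BilinForm.congr L.symm B := by
    ext v w
    rw [h, LinearMap.BilinForm.congr_apply, LinearEquiv.symm_symm]
  rw [hB', LinearMap.BilinForm.nondegenerate_congr_iff]

/-- If `B' (v, w) = B (L v, L w)` for a linear isomorphism `L`, then the quadratic forms of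
`B'` and `B` are equivalent, so they have the same negative index of inertia (Sylvester). [folklore] -/
theorem sigNeg_eq_of_forall_apply_eq {B : LinearMap.BilinForm ℝ E}
    {B' : LinearMap.BilinForm ℝ E'} (L : E' ≃ₗ[ℝ] E) (h : ∀ v w, B' v w = B (L v) (L w)) :
    sigNeg B'.toQuadraticMap = sigNeg B.toQuadraticMap := by
  have hQ : B'.toQuadraticMap = B.toQuadraticMap.comp (L : E' →ₗ[ℝ] E) := by
    ext v
    simp only [LinearMap.BilinMap.toQuadraticMap_apply, QuadraticMap.comp_apply,
      LinearEquiv.coe_coe, h]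
  have hequiv : B'.toQuadraticMap.Equivalent B.toQuadraticMap := by
    rw [hQ]
    exact ⟨(B.toQuadraticMap.isometryEquivOfCompLinearEquiv L).symm⟩
  exact hequiv.sigNeg_eq

end Congruence

/-! ### The Hessian read in an arbitrary chart -/

section Manifold

variable {E H : Type*} [NormedAddCommGroup E] [NormedSpace ℝ E] [TopologicalSpace H]
  (I : ModelWithCorners ℝ E H) {M : Type*} [TopologicalSpace M]

/-- The **Hessian of `f` at `x` read in the chart `e`**: the second derivative (within
`range I`) of `f ∘ (e.extend I)⁻¹` at `e.extend I x`, as a bilinear form on the model space.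
For the preferred chart `e = chartAt H x` this is the tree's `Literature.mhessian I f x`
(`hessianInChart_chartAt`).  Milnor 1963, §2: "in terms of local coordinates, the matrix
`(∂²f/∂xⁱ∂xʲ(p))`". [cite: Milnor1963, §2] -/
def hessianInChart (e : OpenPartialHomeomorph M H) (f : M → ℝ) (x : M) :
    LinearMap.BilinForm ℝ E :=
  (ContinuousLinearMap.coeLM ℝ).comp
    (fderivWithin ℝ (fderivWithin ℝ (f ∘ (e.extend I).symm) (range I)) (range I)
      (e.extend I x)).toLinearMap

variable {I}

/-- Unfolding lemma for `hessianInChart`. [cite: Milnor1963, §2] -/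
theorem hessianInChart_apply_apply (e : OpenPartialHomeomorph M H) (f : M → ℝ) (x : M)
    (v w : E) :
    hessianInChart I e f x v w =
      fderivWithin ℝ (fderivWithin ℝ (f ∘ (e.extend I).symm) (range I)) (range I)
        (e.extend I x) v w :=
  rfl

variable [ChartedSpace H M]

/-- A real-valued function written in the preferred extended chart is `f ∘ (extChartAt I x)⁻¹`,
i.e. `f ∘ ((chartAt H x).extend I)⁻¹`. [folklore] -/
theorem writtenInExtChartAt_eq_comp_extend_symm (f : M → ℝ) (x : M) :
    writtenInExtChartAt I 𝓘(ℝ, ℝ) x f = f ∘ ((chartAt H x).extend I).symm := by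
  ext z; simp [writtenInExtChartAt]

/-- In the preferred chart the chart Hessian is the tree's `mhessian`. [cite: Milnor1963, §2] -/
theorem hessianInChart_chartAt (f : M → ℝ) (x : M) :
    hessianInChart I (chartAt H x) f x = mhessian I f x := by
  ext v w
  rw [hessianInChart_apply_apply, mhessian, ← writtenInExtChartAt_eq_comp_extend_symm]
  rfl

variable [I.Boundaryless]

section ChangeOfChart

variable {f : M → ℝ} {x : M} {e : OpenPartialHomeomorph M H}

/-- `f` read in a chart `e` of the `C²` maximal atlas is `C²` at the image point, if `f` is
`C²` at `x ∈ e.source` (boundaryless case). [folklore] -/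
theorem contDiffAt_comp_extend_symm (hf : ContMDiffAt I 𝓘(ℝ, ℝ) 2 f x)
    (he : e ∈ IsManifold.maximalAtlas I 2 M) (hxe : x ∈ e.source) :
    ContDiffAt ℝ 2 (f ∘ (e.extend I).symm) (e.extend I x) := by
  have h := (contMDiffWithinAt_iff_source_of_mem_maximalAtlas (I' := 𝓘(ℝ, ℝ)) (s := univ)
    he hxe).1 hf.contMDiffWithinAt
  rw [preimage_univ, univ_inter, ModelWithCorners.Boundaryless.range_eq_univ,
    contMDiffWithinAt_iff_contDiffWithinAt, contDiffWithinAt_univ] at h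
  exact h

/-- The change of coordinates from the preferred chart at `x` to a chart `e` of the `C²`
maximal atlas is `C²` at `extChartAt I x x` (boundaryless case). [folklore] -/
theorem contDiffAt_extendCoordChange_chartAt [IsManifold I 2 M]
    (he : e ∈ IsManifold.maximalAtlas I 2 M) (hxe : x ∈ e.source) :
    ContDiffAt ℝ 2 (I.extendCoordChange (chartAt H x) e) (extChartAt I x x) := by
  have h := I.contDiffWithinAt_extendCoordChange' (n := 2)
    (IsManifold.chart_mem_maximalAtlas x) he (mem_chart_source H x) hxe
  rwa [ModelWithCorners.Boundaryless.range_eq_univ, contDiffWithinAt_univ] at h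

/-- The source of that change of coordinates is a neighbourhood of `extChartAt I x x`
(boundaryless case). [folklore] -/
theorem extendCoordChange_source_mem_nhds (hxe : x ∈ e.source) :
    (I.extendCoordChange (chartAt H x) e).source ∈ 𝓝 (extChartAt I x x) := by
  have h := I.extendCoordChange_source_mem_nhdsWithin' (e := chartAt H x) (e' := e)
    (mem_chart_source H x) hxe
  rwa [ModelWithCorners.Boundaryless.range_eq_univ, nhdsWithin_univ] at h

/-- The derivative of that change of coordinates at `extChartAt I x x` is invertible. [folklore] -/
theorem isInvertible_fderiv_extendCoordChange_chartAt [IsManifold I 2 M]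
    (he : e ∈ IsManifold.maximalAtlas I 2 M) (hxe : x ∈ e.source) :
    (fderiv ℝ (I.extendCoordChange (chartAt H x) e) (extChartAt I x x)).IsInvertible := by
  have hmem : extChartAt I x x ∈ (I.extendCoordChange (chartAt H x) e).source :=
    mem_of_mem_nhds (extendCoordChange_source_mem_nhds hxe)
  have h := I.isInvertible_fderivWithin_extendCoordChange (n := 2) (by norm_num)
    (IsManifold.chart_mem_maximalAtlas x) he hmem
  rwa [fderivWithin_of_mem_nhds (extendCoordChange_source_mem_nhds hxe)] at h

/-- Near `extChartAt I x x`, `f` written in the preferred chart factors through the chart `e`: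
`f ∘ (extChartAt I x)⁻¹ = (f ∘ (e.extend I)⁻¹) ∘ τ`, `τ` the change of coordinates. [folklore] -/
theorem writtenInExtChartAt_eventuallyEq_comp_extendCoordChange (hxe : x ∈ e.source) :
    writtenInExtChartAt I 𝓘(ℝ, ℝ) x f =ᶠ[𝓝 (extChartAt I x x)]
      (f ∘ (e.extend I).symm) ∘ I.extendCoordChange (chartAt H x) e := by
  filter_upwards [extendCoordChange_source_mem_nhds hxe] with z hz
  have hz2 : ((chartAt H x).extend I).symm z ∈ e.source := by
    have := hz.2
    simp only [mem_preimage, OpenPartialHomeomorph.extend_source] at this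
    exact this
  simp only [writtenInExtChartAt_eq_comp_extend_symm, Function.comp_apply,
    PartialEquiv.coe_trans]
  rw [e.extend_left_inv hz2]

/-- **Critical points are read in any chart**: `x` is a critical point of the `C²` function `f`
iff `D(f ∘ (e.extend I)⁻¹)(e.extend I x) = 0` for a chart `e` of the `C²` maximal atlas at `x`
(boundaryless case). [cite: Milnor1963, §2] -/
theorem isMCriticalPt_iff_fderiv_comp_extend_symm_eq_zero [IsManifold I 2 M]
    (hf : ContMDiffAt I 𝓘(ℝ, ℝ) 2 f x) (he : e ∈ IsManifold.maximalAtlas I 2 M)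
    (hxe : x ∈ e.source) :
    IsMCriticalPt I f x ↔ fderiv ℝ (f ∘ (e.extend I).symm) (e.extend I x) = 0 := by
  set τ : E → E := ⇑(I.extendCoordChange (chartAt H x) e) with hτ
  have hτ0 : τ (extChartAt I x x) = e.extend I x := by
    simp only [hτ, PartialEquiv.coe_trans, Function.comp_apply]
    exact congrArg (e.extend I) (extChartAt_to_inv x)
  have hd : MDifferentiableAt I 𝓘(ℝ, ℝ) f x := hf.mdifferentiableAt (by norm_num)
  have hFe : DifferentiableAt ℝ (f ∘ (e.extend I).symm) (τ (extChartAt I x x)) := by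
    rw [hτ0]; exact (contDiffAt_comp_extend_symm hf he hxe).differentiableAt (by norm_num)
  have hτd : DifferentiableAt ℝ τ (extChartAt I x x) :=
    (contDiffAt_extendCoordChange_chartAt he hxe).differentiableAt (by norm_num)
  have hchain : fderiv ℝ (writtenInExtChartAt I 𝓘(ℝ, ℝ) x f) (extChartAt I x x) =
      (fderiv ℝ (f ∘ (e.extend I).symm) (e.extend I x)).comp (fderiv ℝ τ (extChartAt I x x)) := by
    rw [(writtenInExtChartAt_eventuallyEq_comp_extendCoordChange hxe).fderiv_eq,
      fderiv_comp _ hFe hτd, hτ0]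
  obtain ⟨L, hL⟩ := isInvertible_fderiv_extendCoordChange_chartAt he hxe
  rw [isMCriticalPt_iff_fderivWithin_writtenInExtChartAt_eq_zero (mem_extChartAt_source x) hd,
    ModelWithCorners.Boundaryless.range_eq_univ, fderivWithin_univ, hchain, ← hL]
  constructor
  · intro h
    have h2 : (fderiv ℝ (f ∘ (e.extend I).symm) (e.extend I x)).comp
        ((L : E →L[ℝ] E).comp (L.symm : E →L[ℝ] E)) = (0 : E →L[ℝ] ℝ).comp (L.symm : E →L[ℝ] E) := by
      rw [← ContinuousLinearMap.comp_assoc, h]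
    simpa using h2
  · intro h
    rw [h, ContinuousLinearMap.zero_comp]

/-- **The Hessian at a critical point is chart-independent up to congruence** (Milnor 1963,
§2, p. 4: "this does not depend on the coordinate system").  On a manifold without boundary,
at a critical point `x` of a `C²` function `f`, for every chart `e` of the `C²` maximal atlas
with `x ∈ e.source`:
`mhessian I f x (v, w) = hessianInChart I e f x (L v, L w)`, where `L`, the derivative at
`extChartAt I x x` of the change of coordinates `e.extend I ∘ (extChartAt I x)⁻¹`, is a linear
automorphism of `E`. [cite: Milnor1963, §2] -/
theorem mhessian_apply_eq_hessianInChart [IsManifold I 2 M] (hf : ContMDiffAt I 𝓘(ℝ, ℝ) 2 f x)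
    (hx : IsMCriticalPt I f x) (he : e ∈ IsManifold.maximalAtlas I 2 M) (hxe : x ∈ e.source)
    (v w : E) :
    mhessian I f x v w = hessianInChart I e f x
      (fderiv ℝ (I.extendCoordChange (chartAt H x) e) (extChartAt I x x) v)
      (fderiv ℝ (I.extendCoordChange (chartAt H x) e) (extChartAt I x x) w) := by
  set τ : E → E := ⇑(I.extendCoordChange (chartAt H x) e) with hτ
  have hτ0 : τ (extChartAt I x x) = e.extend I x := by
    simp only [hτ, PartialEquiv.coe_trans, Function.comp_apply]
    exact congrArg (e.extend I) (extChartAt_to_inv x)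
  have hcrit : fderiv ℝ (f ∘ (e.extend I).symm) (τ (extChartAt I x x)) = 0 := by
    rw [hτ0]; exact (isMCriticalPt_iff_fderiv_comp_extend_symm_eq_zero hf he hxe).1 hx
  have hF : ContDiffAt ℝ 2 (f ∘ (e.extend I).symm) (τ (extChartAt I x x)) := by
    rw [hτ0]; exact contDiffAt_comp_extend_symm hf he hxe
  have key := fderiv_fderiv_comp_apply_of_fderiv_eq_zero hF
    (contDiffAt_extendCoordChange_chartAt he hxe) hcrit v w
  rw [hτ0] at key
  rw [hessianInChart_apply_apply, ModelWithCorners.Boundaryless.range_eq_univ, fderivWithin_univ,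
    fderivWithin_univ, ← key, mhessian]
  simp only [LinearMap.coe_comp, Function.comp_apply, ContinuousLinearMap.coe_coe,
    ContinuousLinearMap.coeLM_apply, ModelWithCorners.Boundaryless.range_eq_univ,
    fderivWithin_univ]
  rw [((writtenInExtChartAt_eventuallyEq_comp_extendCoordChange (f := f) hxe).fderiv).fderiv_eq]

/-- **Nondegeneracy of the Hessian at a critical point is chart-independent** (Milnor 1963,
§2). [cite: Milnor1963, §2] -/
theorem nondegenerate_mhessian_iff [IsManifold I 2 M] (hf : ContMDiffAt I 𝓘(ℝ, ℝ) 2 f x)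
    (hx : IsMCriticalPt I f x) (he : e ∈ IsManifold.maximalAtlas I 2 M) (hxe : x ∈ e.source) :
    (mhessian I f x).Nondegenerate ↔ (hessianInChart I e f x).Nondegenerate := by
  obtain ⟨L, hL⟩ := isInvertible_fderiv_extendCoordChange_chartAt he hxe
  refine nondegenerate_iff_of_forall_apply_eq (L : E ≃L[ℝ] E).toLinearEquiv fun v w => ?_
  rw [mhessian_apply_eq_hessianInChart hf hx he hxe, ← hL]
  rfl

/-- **The Morse index at a critical point is chart-independent**: it is the negative index of
inertia of the Hessian read in any chart of the `C²` maximal atlas (Milnor 1963, §2; Sylvester's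
law of inertia). [cite: Milnor1963, §2] -/
theorem morseIndex_eq_sigNeg_hessianInChart [IsManifold I 2 M]
    (hf : ContMDiffAt I 𝓘(ℝ, ℝ) 2 f x) (hx : IsMCriticalPt I f x) (he : e ∈ IsManifold.maximalAtlas I 2 M) (hxe : x ∈ e.source) :
    morseIndex I f x = sigNeg (hessianInChart I e f x).toQuadraticMap := by
  obtain ⟨L, hL⟩ := isInvertible_fderiv_extendCoordChange_chartAt he hxe
  unfold morseIndex
  refine sigNeg_eq_of_forall_apply_eq (L : E ≃L[ℝ] E).toLinearEquiv fun v w => ?_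
  rw [mhessian_apply_eq_hessianInChart hf hx he hxe, ← hL]
  rfl

end ChangeOfChart

end Manifold

end Literature.Topology.FourManifolds
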